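import Summits.CriticalPhenomena.PercolationContinuityZ3.Theorems.SahiMasterFamilyPrincipalCapC4

/-!
# Sahi's `C₅` on the principal-cap stratum — the order-five certificate (pure algebra)

Unit `prim-masterthm-p4` (gen 13; crux anchor stmt-CriticalPhenomena-4575, helper work; memo
`run/shared/lean/prim/prim-masterthm/prim-masterthm-p4/P4-GEN13-REPORT.md`).  Companion of `…PrincipalCapC3` / `…PrincipalCapC4`
(orders three and four, gen 12).

**THEOREM (`sahiE5_nonneg_of_principalCap`, in the companion file `…PrincipalCapC5`; this file holds its polynomial certificate `key_ineq5`).**  Let `A, B, C, D, E` be increasing events on a finite product of two-point spaces with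
PRINCIPAL common part `A ∩ B ∩ C ∩ D ∩ E = {T | c ⊆ T}`.  Then Sahi's fifth functional `E₅(μ_p; 1_A, …, 1_E)` (the 52-term
signed sum over set partitions, tree `sahiE_five`) is `≥ 0` for every `p ∈ [0,1]^ι` — Sahi's conjecture `C₅` [Sahi2008, Conj. 5] /
the `k = 5` master inequality on product measures, on this stratum.

PROOF (the general mechanism, written out at `k = 5`).  Disjointify the cores `c = K_A ⊔ ⋯ ⊔ K_E`, `X ⊆ [K_X]`, `P_X := ∏_{K_X} p_e`,
so `m_S := μ(⋂_{X∈S} X) ≤ P_S := ∏_{X ∈ S} P_X` for every proper sub-family, `m_{ABCDE} ≥ P := P_A⋯P_E`, and Harris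
`m_X m_Y ≤ m_{XY}`.  NORMALISED FORM (all orders): with `β_S := m_S / P_S ∈ [0,1]` ("probability of the sub-family given that its
cores are open"), `β_{[k]} = 1` and `β_{S∪T} ≥ β_S β_T`, one has `E_k = P · Φ_k(β)`, `Φ_k(β) = Σ_π (−1)^{|π|−1} ∏_B (|B|−1)! β_B`,
and in the defects `d_S = 1 − β_S`, `Φ_k = Σ_i e^D_{[k]∖i} − e^D_{[k]}` with `e^D_T = Σ_{λ ⊢ T} ∏_B (|B|−1)! d_B`: the only NEGATIVE
terms are the singleton-free set partitions of `[k]`.  For `k ≤ 5` every singleton-free partition with `≥ 2` blocks has a block of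
size two, `{i,j}`, and `d_{ij} ≤ 1 − β_iβ_j` (Harris) charges it to the positive term of the partition with `{i,j}` split into two
singletons.  At `k = 5` this is the symmetric 76-term certificate `key_ineq5` below (10 Harris products
`2(P_{klm} − m_{klm})(m_{ij} − m_i m_j)` + 66 products of the atoms `m_i`, `P_S − m_S`), a polynomial identity (`ring`).
(`k = 6` is the first order with a singleton-free partition without a pair, type `(3,3)`; no product-of-atoms certificate exists
there — kit j119780 — and the order-six case is open.)
HONEST FRAMING: `C₅` in general and `C_k` remain OPEN; this is the principal-cap stratum only.  Axioms standard. [this work]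
-/

noncomputable section

open scoped Classical

namespace Summit.CriticalPhenomena.PercolationContinuityZ3.Theorems

namespace PrincipalCapC3

open Finset Function MeasureTheory
open Literature.Combinatorics.Sahi2008
open Literature.Probability.LatticeModels (prodBernoulli prodBernoulli_real_subset)
open Literature.Probability.Percolation.DecisionTree (ind)

variable {ι : Type*} [Fintype ι]

set_option maxHeartbeats 4000000 in
/-- **The order-five certificate** (symmetric, 76 products; the `k = 5` instance of the charging argument of the module
docstring: every singleton-free set partition of `[5]` has type `(2,3)` and is paid for by the Harris gap of its pair). [this work] -/
theorem key_ineq5 {mA mB mC mD mE mAB mAC mAD mAE mBC mBD mBE mCD mCE mDE mABC mABD mABE mACD mACE mADE mBCD mBCE mBDE mCDE mABCD mABCE mABDE mACDE mBCDE mABCDE PA PB PC PD PE : ℝ}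
    (hA : 0 ≤ mA) (hB : 0 ≤ mB) (hC : 0 ≤ mC) (hD : 0 ≤ mD) (hE : 0 ≤ mE)
    (uA : mA ≤ PA) (uB : mB ≤ PB) (uC : mC ≤ PC) (uD : mD ≤ PD)
    (uE : mE ≤ PE) (uAB : mAB ≤ PA * PB) (uAC : mAC ≤ PA * PC) (uAD : mAD ≤ PA * PD)
    (uAE : mAE ≤ PA * PE) (uBC : mBC ≤ PB * PC) (uBD : mBD ≤ PB * PD) (uBE : mBE ≤ PB * PE)
    (uCD : mCD ≤ PC * PD) (uCE : mCE ≤ PC * PE) (uDE : mDE ≤ PD * PE) (uABC : mABC ≤ PA * PB * PC)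
    (uABD : mABD ≤ PA * PB * PD) (uABE : mABE ≤ PA * PB * PE) (uACD : mACD ≤ PA * PC * PD) (uACE : mACE ≤ PA * PC * PE)
    (uADE : mADE ≤ PA * PD * PE) (uBCD : mBCD ≤ PB * PC * PD) (uBCE : mBCE ≤ PB * PC * PE) (uBDE : mBDE ≤ PB * PD * PE)
    (uCDE : mCDE ≤ PC * PD * PE) (uABCD : mABCD ≤ PA * PB * PC * PD) (uABCE : mABCE ≤ PA * PB * PC * PE) (uABDE : mABDE ≤ PA * PB * PD * PE)
    (uACDE : mACDE ≤ PA * PC * PD * PE) (uBCDE : mBCDE ≤ PB * PC * PD * PE) (kAB : mA * mB ≤ mAB) (kAC : mA * mC ≤ mAC)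
    (kAD : mA * mD ≤ mAD) (kAE : mA * mE ≤ mAE) (kBC : mB * mC ≤ mBC) (kBD : mB * mD ≤ mBD)
    (kBE : mB * mE ≤ mBE) (kCD : mC * mD ≤ mCD) (kCE : mC * mE ≤ mCE) (kDE : mD * mE ≤ mDE)
    (htop : PA * PB * PC * PD * PE ≤ mABCDE) :
    0 ≤
      24 * mABCDE
      - 6 * (mBCDE * mA + mACDE * mB + mABDE * mC
             + mABCE * mD + mABCD * mE)
      - 2 * (mABC * mDE + mABD * mCE + mABE * mCD
             + mACD * mBE + mACE * mBD + mADE * mBC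
             + mBCD * mAE + mBCE * mAD + mBDE * mAC
             + mCDE * mAB)
      + 2 * (mABC * mD * mE + mABD * mC * mE + mABE * mC * mD
             + mACD * mB * mE + mACE * mB * mD + mADE * mB * mC
             + mBCD * mA * mE + mBCE * mA * mD + mBDE * mA * mC
             + mCDE * mA * mB)
      + (mAB * mCD * mE + mAB * mCE * mD + mAB * mDE * mC
         + mAC * mBD * mE + mAC * mBE * mD + mAC * mDE * mB
         + mAD * mBC * mE + mAD * mBE * mC + mAD * mCE * mB
         + mAE * mBC * mD + mAE * mBD * mC + mAE * mCD * mB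
         + mBC * mDE * mA + mBD * mCE * mA + mBE * mCD * mA)
      - (mAB * mC * mD * mE + mAC * mB * mD * mE + mAD * mB * mC * mE
         + mAE * mB * mC * mD + mBC * mA * mD * mE + mBD * mA * mC * mE
         + mBE * mA * mC * mD + mCD * mA * mB * mE + mCE * mA * mB * mD
         + mDE * mA * mB * mC)
      + mA * mB * mC * mD * mE := by
  have t1 : 0 ≤ (PB * PC * PD * PE - mBCDE) * mA := (mul_nonneg (sub_nonneg.2 uBCDE) hA)
  have t2 : 0 ≤ (PA * PC * PD * PE - mACDE) * mB := (mul_nonneg (sub_nonneg.2 uACDE) hB)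
  have t3 : 0 ≤ (PC * PD * PE - mCDE) * (mAB - mA * mB) := (mul_nonneg (sub_nonneg.2 uCDE) (sub_nonneg.2 kAB))
  have t4 : 0 ≤ (PB * PC - mBC) * (PD * PE - mDE) * mA := (mul_nonneg (mul_nonneg (sub_nonneg.2 uBC) (sub_nonneg.2 uDE)) hA)
  have t5 : 0 ≤ (PA * PB * PD * PE - mABDE) * mC := (mul_nonneg (sub_nonneg.2 uABDE) hC)
  have t6 : 0 ≤ (PB * PD * PE - mBDE) * (mAC - mA * mC) := (mul_nonneg (sub_nonneg.2 uBDE) (sub_nonneg.2 kAC))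
  have t7 : 0 ≤ (PA * PB - mAB) * (PD * PE - mDE) * mC := (mul_nonneg (mul_nonneg (sub_nonneg.2 uAB) (sub_nonneg.2 uDE)) hC)
  have t8 : 0 ≤ (PA * PC - mAC) * (PD * PE - mDE) * mB := (mul_nonneg (mul_nonneg (sub_nonneg.2 uAC) (sub_nonneg.2 uDE)) hB)
  have t9 : 0 ≤ (PA * PD * PE - mADE) * (mBC - mB * mC) := (mul_nonneg (sub_nonneg.2 uADE) (sub_nonneg.2 kBC))
  have t10 : 0 ≤ (PD * PE - mDE) * mA * (PB - mB) * (PC - mC) := (mul_nonneg (mul_nonneg (mul_nonneg (sub_nonneg.2 uDE) hA) (sub_nonneg.2 uB)) (sub_nonneg.2 uC))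
  have t11 : 0 ≤ (PD * PE - mDE) * mB * (PA - mA) * (PC - mC) := (mul_nonneg (mul_nonneg (mul_nonneg (sub_nonneg.2 uDE) hB) (sub_nonneg.2 uA)) (sub_nonneg.2 uC))
  have t12 : 0 ≤ (PD * PE - mDE) * mC * (PA - mA) * (PB - mB) := (mul_nonneg (mul_nonneg (mul_nonneg (sub_nonneg.2 uDE) hC) (sub_nonneg.2 uA)) (sub_nonneg.2 uB))
  have t13 : 0 ≤ (PD * PE - mDE) * (PA - mA) * (PB - mB) * (PC - mC) := (mul_nonneg (mul_nonneg (mul_nonneg (sub_nonneg.2 uDE) (sub_nonneg.2 uA)) (sub_nonneg.2 uB)) (sub_nonneg.2 uC))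
  have t14 : 0 ≤ (PA * PB * PC * PD - mABCD) * mE := (mul_nonneg (sub_nonneg.2 uABCD) hE)
  have t15 : 0 ≤ (PB * PC * PD - mBCD) * (mAE - mA * mE) := (mul_nonneg (sub_nonneg.2 uBCD) (sub_nonneg.2 kAE))
  have t16 : 0 ≤ (PC * PD - mCD) * (PB * PE - mBE) * mA := (mul_nonneg (mul_nonneg (sub_nonneg.2 uCD) (sub_nonneg.2 uBE)) hA)
  have t17 : 0 ≤ (PA * PB - mAB) * (PC * PD - mCD) * mE := (mul_nonneg (mul_nonneg (sub_nonneg.2 uAB) (sub_nonneg.2 uCD)) hE)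
  have t18 : 0 ≤ (PA * PC * PD - mACD) * (mBE - mB * mE) := (mul_nonneg (sub_nonneg.2 uACD) (sub_nonneg.2 kBE))
  have t19 : 0 ≤ (PC * PD - mCD) * (PA * PE - mAE) * mB := (mul_nonneg (mul_nonneg (sub_nonneg.2 uCD) (sub_nonneg.2 uAE)) hB)
  have t20 : 0 ≤ (PC * PD - mCD) * mA * (PB - mB) * (PE - mE) := (mul_nonneg (mul_nonneg (mul_nonneg (sub_nonneg.2 uCD) hA) (sub_nonneg.2 uB)) (sub_nonneg.2 uE))
  have t21 : 0 ≤ (PC * PD - mCD) * mB * (PA - mA) * (PE - mE) := (mul_nonneg (mul_nonneg (mul_nonneg (sub_nonneg.2 uCD) hB) (sub_nonneg.2 uA)) (sub_nonneg.2 uE))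
  have t22 : 0 ≤ (PC * PD - mCD) * mE * (PA - mA) * (PB - mB) := (mul_nonneg (mul_nonneg (mul_nonneg (sub_nonneg.2 uCD) hE) (sub_nonneg.2 uA)) (sub_nonneg.2 uB))
  have t23 : 0 ≤ (PC * PD - mCD) * (PA - mA) * (PB - mB) * (PE - mE) := (mul_nonneg (mul_nonneg (mul_nonneg (sub_nonneg.2 uCD) (sub_nonneg.2 uA)) (sub_nonneg.2 uB)) (sub_nonneg.2 uE))
  have t24 : 0 ≤ (PB * PD - mBD) * (PC * PE - mCE) * mA := (mul_nonneg (mul_nonneg (sub_nonneg.2 uBD) (sub_nonneg.2 uCE)) hA)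
  have t25 : 0 ≤ (PA * PB * PC * PE - mABCE) * mD := (mul_nonneg (sub_nonneg.2 uABCE) hD)
  have t26 : 0 ≤ (PB * PC * PE - mBCE) * (mAD - mA * mD) := (mul_nonneg (sub_nonneg.2 uBCE) (sub_nonneg.2 kAD))
  have t27 : 0 ≤ (PA * PB - mAB) * (PC * PE - mCE) * mD := (mul_nonneg (mul_nonneg (sub_nonneg.2 uAB) (sub_nonneg.2 uCE)) hD)
  have t28 : 0 ≤ (PA * PD - mAD) * (PC * PE - mCE) * mB := (mul_nonneg (mul_nonneg (sub_nonneg.2 uAD) (sub_nonneg.2 uCE)) hB)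
  have t29 : 0 ≤ (PA * PC * PE - mACE) * (mBD - mB * mD) := (mul_nonneg (sub_nonneg.2 uACE) (sub_nonneg.2 kBD))
  have t30 : 0 ≤ (PC * PE - mCE) * mA * (PB - mB) * (PD - mD) := (mul_nonneg (mul_nonneg (mul_nonneg (sub_nonneg.2 uCE) hA) (sub_nonneg.2 uB)) (sub_nonneg.2 uD))
  have t31 : 0 ≤ (PC * PE - mCE) * mB * (PA - mA) * (PD - mD) := (mul_nonneg (mul_nonneg (mul_nonneg (sub_nonneg.2 uCE) hB) (sub_nonneg.2 uA)) (sub_nonneg.2 uD))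
  have t32 : 0 ≤ (PC * PE - mCE) * mD * (PA - mA) * (PB - mB) := (mul_nonneg (mul_nonneg (mul_nonneg (sub_nonneg.2 uCE) hD) (sub_nonneg.2 uA)) (sub_nonneg.2 uB))
  have t33 : 0 ≤ (PC * PE - mCE) * (PA - mA) * (PB - mB) * (PD - mD) := (mul_nonneg (mul_nonneg (mul_nonneg (sub_nonneg.2 uCE) (sub_nonneg.2 uA)) (sub_nonneg.2 uB)) (sub_nonneg.2 uD))
  have t34 : 0 ≤ (PA * PB * PC - mABC) * (mDE - mD * mE) := (mul_nonneg (sub_nonneg.2 uABC) (sub_nonneg.2 kDE))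
  have t35 : 0 ≤ (PB * PC - mBC) * (PA * PD - mAD) * mE := (mul_nonneg (mul_nonneg (sub_nonneg.2 uBC) (sub_nonneg.2 uAD)) hE)
  have t36 : 0 ≤ (PB * PC - mBC) * (PA * PE - mAE) * mD := (mul_nonneg (mul_nonneg (sub_nonneg.2 uBC) (sub_nonneg.2 uAE)) hD)
  have t37 : 0 ≤ (PB * PC - mBC) * mA * (PD - mD) * (PE - mE) := (mul_nonneg (mul_nonneg (mul_nonneg (sub_nonneg.2 uBC) hA) (sub_nonneg.2 uD)) (sub_nonneg.2 uE))
  have t38 : 0 ≤ (PB * PC - mBC) * mD * (PA - mA) * (PE - mE) := (mul_nonneg (mul_nonneg (mul_nonneg (sub_nonneg.2 uBC) hD) (sub_nonneg.2 uA)) (sub_nonneg.2 uE))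
  have t39 : 0 ≤ (PB * PC - mBC) * mE * (PA - mA) * (PD - mD) := (mul_nonneg (mul_nonneg (mul_nonneg (sub_nonneg.2 uBC) hE) (sub_nonneg.2 uA)) (sub_nonneg.2 uD))
  have t40 : 0 ≤ (PB * PC - mBC) * (PA - mA) * (PD - mD) * (PE - mE) := (mul_nonneg (mul_nonneg (mul_nonneg (sub_nonneg.2 uBC) (sub_nonneg.2 uA)) (sub_nonneg.2 uD)) (sub_nonneg.2 uE))
  have t41 : 0 ≤ (PA * PC - mAC) * (PB * PD - mBD) * mE := (mul_nonneg (mul_nonneg (sub_nonneg.2 uAC) (sub_nonneg.2 uBD)) hE)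
  have t42 : 0 ≤ (PA * PB * PD - mABD) * (mCE - mC * mE) := (mul_nonneg (sub_nonneg.2 uABD) (sub_nonneg.2 kCE))
  have t43 : 0 ≤ (PB * PD - mBD) * (PA * PE - mAE) * mC := (mul_nonneg (mul_nonneg (sub_nonneg.2 uBD) (sub_nonneg.2 uAE)) hC)
  have t44 : 0 ≤ (PB * PD - mBD) * mA * (PC - mC) * (PE - mE) := (mul_nonneg (mul_nonneg (mul_nonneg (sub_nonneg.2 uBD) hA) (sub_nonneg.2 uC)) (sub_nonneg.2 uE))
  have t45 : 0 ≤ (PB * PD - mBD) * mC * (PA - mA) * (PE - mE) := (mul_nonneg (mul_nonneg (mul_nonneg (sub_nonneg.2 uBD) hC) (sub_nonneg.2 uA)) (sub_nonneg.2 uE))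
  have t46 : 0 ≤ (PB * PD - mBD) * mE * (PA - mA) * (PC - mC) := (mul_nonneg (mul_nonneg (mul_nonneg (sub_nonneg.2 uBD) hE) (sub_nonneg.2 uA)) (sub_nonneg.2 uC))
  have t47 : 0 ≤ (PB * PD - mBD) * (PA - mA) * (PC - mC) * (PE - mE) := (mul_nonneg (mul_nonneg (mul_nonneg (sub_nonneg.2 uBD) (sub_nonneg.2 uA)) (sub_nonneg.2 uC)) (sub_nonneg.2 uE))
  have t48 : 0 ≤ (PA * PC - mAC) * (PB * PE - mBE) * mD := (mul_nonneg (mul_nonneg (sub_nonneg.2 uAC) (sub_nonneg.2 uBE)) hD)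
  have t49 : 0 ≤ (PA * PD - mAD) * (PB * PE - mBE) * mC := (mul_nonneg (mul_nonneg (sub_nonneg.2 uAD) (sub_nonneg.2 uBE)) hC)
  have t50 : 0 ≤ (PA * PB * PE - mABE) * (mCD - mC * mD) := (mul_nonneg (sub_nonneg.2 uABE) (sub_nonneg.2 kCD))
  have t51 : 0 ≤ (PB * PE - mBE) * mA * (PC - mC) * (PD - mD) := (mul_nonneg (mul_nonneg (mul_nonneg (sub_nonneg.2 uBE) hA) (sub_nonneg.2 uC)) (sub_nonneg.2 uD))
  have t52 : 0 ≤ (PB * PE - mBE) * mC * (PA - mA) * (PD - mD) := (mul_nonneg (mul_nonneg (mul_nonneg (sub_nonneg.2 uBE) hC) (sub_nonneg.2 uA)) (sub_nonneg.2 uD))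
  have t53 : 0 ≤ (PB * PE - mBE) * mD * (PA - mA) * (PC - mC) := (mul_nonneg (mul_nonneg (mul_nonneg (sub_nonneg.2 uBE) hD) (sub_nonneg.2 uA)) (sub_nonneg.2 uC))
  have t54 : 0 ≤ (PB * PE - mBE) * (PA - mA) * (PC - mC) * (PD - mD) := (mul_nonneg (mul_nonneg (mul_nonneg (sub_nonneg.2 uBE) (sub_nonneg.2 uA)) (sub_nonneg.2 uC)) (sub_nonneg.2 uD))
  have t55 : 0 ≤ (PA * PB - mAB) * mC * (PD - mD) * (PE - mE) := (mul_nonneg (mul_nonneg (mul_nonneg (sub_nonneg.2 uAB) hC) (sub_nonneg.2 uD)) (sub_nonneg.2 uE))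
  have t56 : 0 ≤ (PA * PB - mAB) * mD * (PC - mC) * (PE - mE) := (mul_nonneg (mul_nonneg (mul_nonneg (sub_nonneg.2 uAB) hD) (sub_nonneg.2 uC)) (sub_nonneg.2 uE))
  have t57 : 0 ≤ (PA * PB - mAB) * mE * (PC - mC) * (PD - mD) := (mul_nonneg (mul_nonneg (mul_nonneg (sub_nonneg.2 uAB) hE) (sub_nonneg.2 uC)) (sub_nonneg.2 uD))
  have t58 : 0 ≤ (PA * PB - mAB) * (PC - mC) * (PD - mD) * (PE - mE) := (mul_nonneg (mul_nonneg (mul_nonneg (sub_nonneg.2 uAB) (sub_nonneg.2 uC)) (sub_nonneg.2 uD)) (sub_nonneg.2 uE))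
  have t59 : 0 ≤ (PA * PC - mAC) * mB * (PD - mD) * (PE - mE) := (mul_nonneg (mul_nonneg (mul_nonneg (sub_nonneg.2 uAC) hB) (sub_nonneg.2 uD)) (sub_nonneg.2 uE))
  have t60 : 0 ≤ (PA * PC - mAC) * mD * (PB - mB) * (PE - mE) := (mul_nonneg (mul_nonneg (mul_nonneg (sub_nonneg.2 uAC) hD) (sub_nonneg.2 uB)) (sub_nonneg.2 uE))
  have t61 : 0 ≤ (PA * PC - mAC) * mE * (PB - mB) * (PD - mD) := (mul_nonneg (mul_nonneg (mul_nonneg (sub_nonneg.2 uAC) hE) (sub_nonneg.2 uB)) (sub_nonneg.2 uD))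
  have t62 : 0 ≤ (PA * PC - mAC) * (PB - mB) * (PD - mD) * (PE - mE) := (mul_nonneg (mul_nonneg (mul_nonneg (sub_nonneg.2 uAC) (sub_nonneg.2 uB)) (sub_nonneg.2 uD)) (sub_nonneg.2 uE))
  have t63 : 0 ≤ (PA * PD - mAD) * mB * (PC - mC) * (PE - mE) := (mul_nonneg (mul_nonneg (mul_nonneg (sub_nonneg.2 uAD) hB) (sub_nonneg.2 uC)) (sub_nonneg.2 uE))
  have t64 : 0 ≤ (PA * PD - mAD) * mC * (PB - mB) * (PE - mE) := (mul_nonneg (mul_nonneg (mul_nonneg (sub_nonneg.2 uAD) hC) (sub_nonneg.2 uB)) (sub_nonneg.2 uE))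
  have t65 : 0 ≤ (PA * PD - mAD) * mE * (PB - mB) * (PC - mC) := (mul_nonneg (mul_nonneg (mul_nonneg (sub_nonneg.2 uAD) hE) (sub_nonneg.2 uB)) (sub_nonneg.2 uC))
  have t66 : 0 ≤ (PA * PD - mAD) * (PB - mB) * (PC - mC) * (PE - mE) := (mul_nonneg (mul_nonneg (mul_nonneg (sub_nonneg.2 uAD) (sub_nonneg.2 uB)) (sub_nonneg.2 uC)) (sub_nonneg.2 uE))
  have t67 : 0 ≤ (PA * PE - mAE) * mB * (PC - mC) * (PD - mD) := (mul_nonneg (mul_nonneg (mul_nonneg (sub_nonneg.2 uAE) hB) (sub_nonneg.2 uC)) (sub_nonneg.2 uD))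
  have t68 : 0 ≤ (PA * PE - mAE) * mC * (PB - mB) * (PD - mD) := (mul_nonneg (mul_nonneg (mul_nonneg (sub_nonneg.2 uAE) hC) (sub_nonneg.2 uB)) (sub_nonneg.2 uD))
  have t69 : 0 ≤ (PA * PE - mAE) * mD * (PB - mB) * (PC - mC) := (mul_nonneg (mul_nonneg (mul_nonneg (sub_nonneg.2 uAE) hD) (sub_nonneg.2 uB)) (sub_nonneg.2 uC))
  have t70 : 0 ≤ (PA * PE - mAE) * (PB - mB) * (PC - mC) * (PD - mD) := (mul_nonneg (mul_nonneg (mul_nonneg (sub_nonneg.2 uAE) (sub_nonneg.2 uB)) (sub_nonneg.2 uC)) (sub_nonneg.2 uD))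
  have t71 : 0 ≤ mA * (PB - mB) * (PC - mC) * (PD - mD) * (PE - mE) := (mul_nonneg (mul_nonneg (mul_nonneg (mul_nonneg hA (sub_nonneg.2 uB)) (sub_nonneg.2 uC)) (sub_nonneg.2 uD)) (sub_nonneg.2 uE))
  have t72 : 0 ≤ mB * (PA - mA) * (PC - mC) * (PD - mD) * (PE - mE) := (mul_nonneg (mul_nonneg (mul_nonneg (mul_nonneg hB (sub_nonneg.2 uA)) (sub_nonneg.2 uC)) (sub_nonneg.2 uD)) (sub_nonneg.2 uE))
  have t73 : 0 ≤ mC * (PA - mA) * (PB - mB) * (PD - mD) * (PE - mE) := (mul_nonneg (mul_nonneg (mul_nonneg (mul_nonneg hC (sub_nonneg.2 uA)) (sub_nonneg.2 uB)) (sub_nonneg.2 uD)) (sub_nonneg.2 uE))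
  have t74 : 0 ≤ mD * (PA - mA) * (PB - mB) * (PC - mC) * (PE - mE) := (mul_nonneg (mul_nonneg (mul_nonneg (mul_nonneg hD (sub_nonneg.2 uA)) (sub_nonneg.2 uB)) (sub_nonneg.2 uC)) (sub_nonneg.2 uE))
  have t75 : 0 ≤ mE * (PA - mA) * (PB - mB) * (PC - mC) * (PD - mD) := (mul_nonneg (mul_nonneg (mul_nonneg (mul_nonneg hE (sub_nonneg.2 uA)) (sub_nonneg.2 uB)) (sub_nonneg.2 uC)) (sub_nonneg.2 uD))
  have t76 : 0 ≤ (PA - mA) * (PB - mB) * (PC - mC) * (PD - mD) * (PE - mE) := (mul_nonneg (mul_nonneg (mul_nonneg (mul_nonneg (sub_nonneg.2 uA) (sub_nonneg.2 uB)) (sub_nonneg.2 uC)) (sub_nonneg.2 uD)) (sub_nonneg.2 uE))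
  have e : 6 * ((PB * PC * PD * PE - mBCDE) * mA)
      + 6 * ((PA * PC * PD * PE - mACDE) * mB)
      + 2 * ((PC * PD * PE - mCDE) * (mAB - mA * mB))
      + ((PB * PC - mBC) * (PD * PE - mDE) * mA)
      + 6 * ((PA * PB * PD * PE - mABDE) * mC)
      + 2 * ((PB * PD * PE - mBDE) * (mAC - mA * mC))
      + ((PA * PB - mAB) * (PD * PE - mDE) * mC)
      + ((PA * PC - mAC) * (PD * PE - mDE) * mB)
      + 2 * ((PA * PD * PE - mADE) * (mBC - mB * mC))
      + ((PD * PE - mDE) * mA * (PB - mB) * (PC - mC))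
      + ((PD * PE - mDE) * mB * (PA - mA) * (PC - mC))
      + ((PD * PE - mDE) * mC * (PA - mA) * (PB - mB))
      + 2 * ((PD * PE - mDE) * (PA - mA) * (PB - mB) * (PC - mC))
      + 6 * ((PA * PB * PC * PD - mABCD) * mE)
      + 2 * ((PB * PC * PD - mBCD) * (mAE - mA * mE))
      + ((PC * PD - mCD) * (PB * PE - mBE) * mA)
      + ((PA * PB - mAB) * (PC * PD - mCD) * mE)
      + 2 * ((PA * PC * PD - mACD) * (mBE - mB * mE))
      + ((PC * PD - mCD) * (PA * PE - mAE) * mB)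
      + ((PC * PD - mCD) * mA * (PB - mB) * (PE - mE))
      + ((PC * PD - mCD) * mB * (PA - mA) * (PE - mE))
      + ((PC * PD - mCD) * mE * (PA - mA) * (PB - mB))
      + 2 * ((PC * PD - mCD) * (PA - mA) * (PB - mB) * (PE - mE))
      + ((PB * PD - mBD) * (PC * PE - mCE) * mA)
      + 6 * ((PA * PB * PC * PE - mABCE) * mD)
      + 2 * ((PB * PC * PE - mBCE) * (mAD - mA * mD))
      + ((PA * PB - mAB) * (PC * PE - mCE) * mD)
      + ((PA * PD - mAD) * (PC * PE - mCE) * mB)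
      + 2 * ((PA * PC * PE - mACE) * (mBD - mB * mD))
      + ((PC * PE - mCE) * mA * (PB - mB) * (PD - mD))
      + ((PC * PE - mCE) * mB * (PA - mA) * (PD - mD))
      + ((PC * PE - mCE) * mD * (PA - mA) * (PB - mB))
      + 2 * ((PC * PE - mCE) * (PA - mA) * (PB - mB) * (PD - mD))
      + 2 * ((PA * PB * PC - mABC) * (mDE - mD * mE))
      + ((PB * PC - mBC) * (PA * PD - mAD) * mE)
      + ((PB * PC - mBC) * (PA * PE - mAE) * mD)
      + ((PB * PC - mBC) * mA * (PD - mD) * (PE - mE))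
      + ((PB * PC - mBC) * mD * (PA - mA) * (PE - mE))
      + ((PB * PC - mBC) * mE * (PA - mA) * (PD - mD))
      + 2 * ((PB * PC - mBC) * (PA - mA) * (PD - mD) * (PE - mE))
      + ((PA * PC - mAC) * (PB * PD - mBD) * mE)
      + 2 * ((PA * PB * PD - mABD) * (mCE - mC * mE))
      + ((PB * PD - mBD) * (PA * PE - mAE) * mC)
      + ((PB * PD - mBD) * mA * (PC - mC) * (PE - mE))
      + ((PB * PD - mBD) * mC * (PA - mA) * (PE - mE))
      + ((PB * PD - mBD) * mE * (PA - mA) * (PC - mC))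
      + 2 * ((PB * PD - mBD) * (PA - mA) * (PC - mC) * (PE - mE))
      + ((PA * PC - mAC) * (PB * PE - mBE) * mD)
      + ((PA * PD - mAD) * (PB * PE - mBE) * mC)
      + 2 * ((PA * PB * PE - mABE) * (mCD - mC * mD))
      + ((PB * PE - mBE) * mA * (PC - mC) * (PD - mD))
      + ((PB * PE - mBE) * mC * (PA - mA) * (PD - mD))
      + ((PB * PE - mBE) * mD * (PA - mA) * (PC - mC))
      + 2 * ((PB * PE - mBE) * (PA - mA) * (PC - mC) * (PD - mD))
      + ((PA * PB - mAB) * mC * (PD - mD) * (PE - mE))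
      + ((PA * PB - mAB) * mD * (PC - mC) * (PE - mE))
      + ((PA * PB - mAB) * mE * (PC - mC) * (PD - mD))
      + 2 * ((PA * PB - mAB) * (PC - mC) * (PD - mD) * (PE - mE))
      + ((PA * PC - mAC) * mB * (PD - mD) * (PE - mE))
      + ((PA * PC - mAC) * mD * (PB - mB) * (PE - mE))
      + ((PA * PC - mAC) * mE * (PB - mB) * (PD - mD))
      + 2 * ((PA * PC - mAC) * (PB - mB) * (PD - mD) * (PE - mE))
      + ((PA * PD - mAD) * mB * (PC - mC) * (PE - mE))
      + ((PA * PD - mAD) * mC * (PB - mB) * (PE - mE))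
      + ((PA * PD - mAD) * mE * (PB - mB) * (PC - mC))
      + 2 * ((PA * PD - mAD) * (PB - mB) * (PC - mC) * (PE - mE))
      + ((PA * PE - mAE) * mB * (PC - mC) * (PD - mD))
      + ((PA * PE - mAE) * mC * (PB - mB) * (PD - mD))
      + ((PA * PE - mAE) * mD * (PB - mB) * (PC - mC))
      + 2 * ((PA * PE - mAE) * (PB - mB) * (PC - mC) * (PD - mD))
      + (mA * (PB - mB) * (PC - mC) * (PD - mD) * (PE - mE))
      + (mB * (PA - mA) * (PC - mC) * (PD - mD) * (PE - mE))
      + (mC * (PA - mA) * (PB - mB) * (PD - mD) * (PE - mE))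
      + (mD * (PA - mA) * (PB - mB) * (PC - mC) * (PE - mE))
      + (mE * (PA - mA) * (PB - mB) * (PC - mC) * (PD - mD))
      + 4 * ((PA - mA) * (PB - mB) * (PC - mC) * (PD - mD) * (PE - mE))
      =
      24 * (PA * PB * PC * PD * PE)
      - 6 * (mBCDE * mA + mACDE * mB + mABDE * mC
             + mABCE * mD + mABCD * mE)
      - 2 * (mABC * mDE + mABD * mCE + mABE * mCD
             + mACD * mBE + mACE * mBD + mADE * mBC
             + mBCD * mAE + mBCE * mAD + mBDE * mAC
             + mCDE * mAB)
      + 2 * (mABC * mD * mE + mABD * mC * mE + mABE * mC * mD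
             + mACD * mB * mE + mACE * mB * mD + mADE * mB * mC
             + mBCD * mA * mE + mBCE * mA * mD + mBDE * mA * mC
             + mCDE * mA * mB)
      + (mAB * mCD * mE + mAB * mCE * mD + mAB * mDE * mC
         + mAC * mBD * mE + mAC * mBE * mD + mAC * mDE * mB
         + mAD * mBC * mE + mAD * mBE * mC + mAD * mCE * mB
         + mAE * mBC * mD + mAE * mBD * mC + mAE * mCD * mB
         + mBC * mDE * mA + mBD * mCE * mA + mBE * mCD * mA)
      - (mAB * mC * mD * mE + mAC * mB * mD * mE + mAD * mB * mC * mE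
         + mAE * mB * mC * mD + mBC * mA * mD * mE + mBD * mA * mC * mE
         + mBE * mA * mC * mD + mCD * mA * mB * mE + mCE * mA * mB * mD
         + mDE * mA * mB * mC)
      + mA * mB * mC * mD * mE := by ring
  linarith [t1, t2, t3, t4, t5, t6, t7, t8, t9, t10, t11, t12, t13, t14, t15, t16, t17, t18, t19, t20, t21, t22, t23, t24, t25, t26, t27, t28, t29, t30, t31, t32, t33, t34, t35, t36, t37, t38, t39, t40, t41, t42, t43, t44, t45, t46, t47, t48, t49, t50, t51, t52, t53, t54, t55, t56, t57, t58, t59, t60, t61, t62, t63, t64, t65, t66, t67, t68, t69, t70, t71, t72, t73, t74, t75, t76, e, htop]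


end PrincipalCapC3

end Summit.CriticalPhenomena.PercolationContinuityZ3.Theorems
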